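import Summits.KontsevichZagierPeriods.KontsevichZagierPeriods.Theorems.PlanarK0Injective.Negative.Kit

/-!
# `PlanarK0Injective` (stmt-KontsevichZagierPeriods-9847) — negative side II: one change-of-variables move is not enough

Refuter (`cdisprove`, cycle 1) by-products for the crux `PlanarK0Injective` of route `SymplecticScissors`,
on top of `Negative/Kit.lean`: two refuted natural strengthenings showing that rule (1a) (curved
scissors) is load-bearing in the crux and that the Monge form must discard null sets AND cut:

* `not_planarOneMove` — `[0,1]²` and `(0,1)²` (equal area, they differ by a null set) are not related
  by ONE change-of-variables move: the move's map is differentiable within the source at every point,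
  hence continuous on the compact closed square, so the image is compact; the free group pins the
  instance to the pair (`eq_of_of_sub_of_eq`).
* `not_planarOneMoveOpen` — even between OPEN planar sets: `(0,1)²` (convex, preconnected) is not
  ONE move away from `(0,½)×(0,1) ∪ (1,3/2)×(0,1)` (not preconnected); a chain needs the cut along
  `x = ½` first.
[Kontsevich–Zagier 2001, §1.2 rule (2); Cresson–Viu-Sos 2022, Problem 2.1]
-/

noncomputable section

open MeasureTheory Set MvPolynomial
open Literature.NumberTheory.Transcendental Literature.ModelTheory.ExponentialFields

namespace Summit.KontsevichZagierPeriods.SymplecticScissors.PlanarK0InjectiveNegative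

/-! ## One change-of-variables move is not enough -/

/-- NATURAL STRENGTHENING I (the Monge form WITHOUT discarding null sets): equal-area planar sets
differ by ONE change-of-variables move (a refuted strengthening, stated here only to be negated). -/
def PlanarOneMove : Prop :=
  ∀ r r' : KZ.IntegralRep 2, (∀ p ∈ r.domain, r.integrand p = 1) →
    (∀ p ∈ r'.domain, r'.integrand p = 1) → r.value = r'.value →
    KZ.of r - KZ.of r' ∈ KZ.changeOfVariablesRel

/-- **Refuted strengthening / rule (1a) is load-bearing**: `[0,1]²` and `(0,1)²` (same area, they
even differ by a null set) are NOT related by a single change-of-variables move: the move's map is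
differentiable within the source at every point, hence continuous on the compact closed square,
so its image is compact — but the image must be the open square. In the free abelian group the
instance is pinned to the pair itself (`eq_of_of_sub_of_eq`). So `PlanarTransport` is right to
discard null sets, and the chain form needs rule (1a). [folklore] -/
theorem not_planarOneMove : ¬ PlanarOneMove := by
  intro h
  have hmem := h closedUnitSquare openUnitSquare (fun _ _ => rfl) (fun _ _ => rfl)
    (by rw [value_closedUnitSquare, value_openUnitSquare])
  obtain ⟨n, r₀, r₀', Φ, Φ', -, hder, -, hdom, -, hEq⟩ := hmem
  have hne : (⟨2, closedUnitSquare⟩ : Σ n, KZ.IntegralRep n) ≠ ⟨2, openUnitSquare⟩ := fun h' =>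
    openUnitSquare_ne_closedUnitSquare (by
      rw [Sigma.mk.inj_iff] at h'
      exact (eq_of_heq h'.2).symm)
  obtain ⟨h1, h2⟩ := eq_of_of_sub_of_eq hne hEq
  rw [Sigma.mk.inj_iff] at h1 h2
  obtain ⟨rfl, h1⟩ := h1
  obtain ⟨-, h2⟩ := h2
  have e1 : closedUnitSquare = r₀ := eq_of_heq h1
  have e2 : openUnitSquare = r₀' := eq_of_heq h2
  subst e1 e2
  have hcont : ContinuousOn Φ closedUnitSquare.domain := fun x hx => (hder x hx).continuousWithinAt
  have hK : IsCompact openUnitSquare.domain := by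
    rw [hdom]; exact isCompact_closedUnitSquare.image_of_continuousOn hcont
  exact not_isCompact_openUnitSquare hK

/-! ### §3b One move is not enough even between OPEN planar sets: connectedness -/

/-- Two disjoint open half-boxes `(0,½)×(0,1) ∪ (1,3/2)×(0,1)` as ONE planar set (area `1`). [folklore] -/
def twoBoxRep : KZ.IntegralRep 2 where
  domain := (boxRep ![0, 0] ![1 / 2, 1]).domain ∪ (boxRep ![1, 0] ![3 / 2, 1]).domain
  integrand := fun _ => 1
  isSemialgebraic_domain :=
    (boxRep ![0, 0] ![1 / 2, 1]).isSemialgebraic_domain.union (boxRep ![1, 0] ![3 / 2, 1]).isSemialgebraic_domain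
  isSemialgebraicFunOn_integrand := isSemialgebraicFunOn_one
    ((boxRep ![0, 0] ![1 / 2, 1]).isSemialgebraic_domain.union (boxRep ![1, 0] ![3 / 2, 1]).isSemialgebraic_domain)
  integrableOn := integrableOn_const
    (measure_union_ne_top (volume_box_ne_top _ _) (volume_box_ne_top _ _))

/-- The left half-box lies in `{x < 3/4}`, the right one in `{3/4 < x}`. [folklore] -/
theorem twoBoxRep_subset :
    twoBoxRep.domain ⊆ {p : Fin 2 → ℝ | p 0 < 3 / 4} ∪ {p : Fin 2 → ℝ | 3 / 4 < p 0} := by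
  rintro p (hp | hp)
  · left
    rw [boxRep_domain, mem_box] at hp
    have h := (hp 0).2
    simp at h
    show p 0 < 3 / 4
    linarith
  · right
    rw [boxRep_domain, mem_box] at hp
    have h := (hp 0).1
    simp at h
    show 3 / 4 < p 0
    linarith

/-- The two half-boxes are disjoint (separated by the strip `½ ≤ x ≤ 1`). [folklore] -/
theorem disjoint_halfBoxes :
    Disjoint (boxRep ![0, 0] ![1 / 2, 1]).domain (boxRep ![1, 0] ![3 / 2, 1]).domain := by
  rw [Set.disjoint_left]
  intro p hp hp'
  rw [boxRep_domain, mem_box] at hp hp'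
  have h1 := (hp 0).2
  have h2 := (hp' 0).1
  simp at h1 h2
  linarith

/-- The two-box set has area `1`. [folklore] -/
theorem value_twoBoxRep : twoBoxRep.value = 1 := by
  have hA := value_boxRep (l := ![0, 0]) (u := ![1 / 2, 1]) (fun i => by fin_cases i <;> norm_num)
  have hB := value_boxRep (l := ![1, 0]) (u := ![3 / 2, 1]) (fun i => by fin_cases i <;> norm_num)
  simp only [KZ.IntegralRep.value, boxRep_integrand] at hA hB
  have hmeas : MeasurableSet (boxRep ![1, 0] ![3 / 2, 1]).domain :=
    KZ.IntegralRep.measurableSet_domain_holds _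
  simp only [KZ.IntegralRep.value, twoBoxRep]
  rw [setIntegral_union disjoint_halfBoxes hmeas (integrableOn_const (volume_box_ne_top _ _))
    (integrableOn_const (volume_box_ne_top _ _)), hA, hB]
  norm_num

/-- The two-box set is not preconnected (the open half-planes `{x < 3/4}`, `{3/4 < x}` separate it). [folklore] -/
theorem not_isPreconnected_twoBoxRep : ¬ IsPreconnected twoBoxRep.domain := by
  intro h
  have hu : IsOpen {p : Fin 2 → ℝ | p 0 < 3 / 4} := isOpen_lt (continuous_apply 0) continuous_const
  have hv : IsOpen {p : Fin 2 → ℝ | 3 / 4 < p 0} := isOpen_lt continuous_const (continuous_apply 0)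
  have hne_u : (twoBoxRep.domain ∩ {p : Fin 2 → ℝ | p 0 < 3 / 4}).Nonempty := by
    refine ⟨![1 / 4, 1 / 2], Or.inl ?_, by show (![1 / 4, 1 / 2] : Fin 2 → ℝ) 0 < 3 / 4; simp; norm_num⟩
    rw [boxRep_domain, mem_box]
    intro i; fin_cases i <;> simp <;> norm_num
  have hne_v : (twoBoxRep.domain ∩ {p : Fin 2 → ℝ | 3 / 4 < p 0}).Nonempty := by
    refine ⟨![5 / 4, 1 / 2], Or.inr ?_, by show (3 : ℝ) / 4 < (![5 / 4, 1 / 2] : Fin 2 → ℝ) 0; simp; norm_num⟩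
    rw [boxRep_domain, mem_box]
    intro i; fin_cases i <;> simp <;> norm_num
  obtain ⟨p, -, hpu, hpv⟩ := h _ _ hu hv twoBoxRep_subset hne_u hne_v
  have h1 : p 0 < 3 / 4 := hpu
  have h2 : 3 / 4 < p 0 := hpv
  linarith

/-- NATURAL STRENGTHENING I′ (one move between OPEN planar sets of equal area; a refuted
strengthening, stated here only to be negated). -/
def PlanarOneMoveOpen : Prop :=
  ∀ r r' : KZ.IntegralRep 2, IsOpen r.domain → IsOpen r'.domain →
    (∀ p ∈ r.domain, r.integrand p = 1) → (∀ p ∈ r'.domain, r'.integrand p = 1) →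
    r.value = r'.value → KZ.of r - KZ.of r' ∈ KZ.changeOfVariablesRel

/-- The open unit square is open. [folklore] -/
theorem isOpen_openUnitSquare : IsOpen openUnitSquare.domain := by
  rw [boxRep_domain, box]
  exact isOpen_set_pi finite_univ fun _ _ => isOpen_Ioo

/-- The two-box set is open. [folklore] -/
theorem isOpen_twoBoxRep : IsOpen twoBoxRep.domain :=
  (isOpen_set_pi finite_univ fun _ _ => isOpen_Ioo).union
    (isOpen_set_pi finite_univ fun _ _ => isOpen_Ioo)

/-- **Refuted strengthening I′ / cutting is load-bearing beyond null-set bookkeeping**: even between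
OPEN planar sets of equal area ONE change-of-variables move may be impossible — `(0,1)²` is
preconnected (convex), a move's map is continuous on its source, so its image is preconnected, while
`(0,½)×(0,1) ∪ (1,3/2)×(0,1)` is not. A chain for this pair needs a cut (rule 1a along `x = ½`, a
null segment) before the two translations. [folklore] -/
theorem not_planarOneMoveOpen : ¬ PlanarOneMoveOpen := by
  intro h
  have hmem := h openUnitSquare twoBoxRep isOpen_openUnitSquare isOpen_twoBoxRep
    (fun _ _ => rfl) (fun _ _ => rfl) (by rw [value_openUnitSquare, value_twoBoxRep])
  obtain ⟨n, r₀, r₀', Φ, Φ', -, hder, -, hdom, -, hEq⟩ := hmem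
  have hne : (⟨2, openUnitSquare⟩ : Σ n, KZ.IntegralRep n) ≠ ⟨2, twoBoxRep⟩ := by
    intro h'
    rw [Sigma.mk.inj_iff] at h'
    have e : openUnitSquare = twoBoxRep := eq_of_heq h'.2
    have hp : (![5 / 4, 1 / 2] : Fin 2 → ℝ) ∈ twoBoxRep.domain := by
      refine Or.inr ?_
      rw [boxRep_domain, mem_box]
      intro i; fin_cases i <;> simp <;> norm_num
    rw [← e, mem_openUnitSquare] at hp
    norm_num at hp
  obtain ⟨h1, h2⟩ := eq_of_of_sub_of_eq hne hEq
  rw [Sigma.mk.inj_iff] at h1 h2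
  obtain ⟨rfl, h1⟩ := h1
  obtain ⟨-, h2⟩ := h2
  have e1 : openUnitSquare = r₀ := eq_of_heq h1
  have e2 : twoBoxRep = r₀' := eq_of_heq h2
  subst e1 e2
  have hcont : ContinuousOn Φ openUnitSquare.domain := fun x hx => (hder x hx).continuousWithinAt
  have hconv : Convex ℝ openUnitSquare.domain := by
    rw [boxRep_domain, box]
    exact convex_pi fun _ _ => convex_Ioo _ _
  have hpre : IsPreconnected twoBoxRep.domain := by
    rw [hdom]; exact hconv.isPreconnected.image Φ hcont
  exact not_isPreconnected_twoBoxRep hpre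

end Summit.KontsevichZagierPeriods.SymplecticScissors.PlanarK0InjectiveNegative
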